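/-
Copyright (c) 2026 the pub-hodgecm-mathlib formalisation cell (harness21).  Prover seat hodgecm-mathlib-K2Liu-p06 (g2): Track B «K2-LIT»,
#184♮ = hLiu418 = stmt-HodgeConjecture-24832; organ O33.7a for socket #33s `sig_K2LiuZetaSNonvanishingData` of the tier-1 socket module
`Cruxes/HLiu418/Lines/K2_Liu_CurveThetaSigs_U5d_ZetaS.lean` (ED. 3, sha16 7c2f436314d56d7b, :426; LEAD F0P6-plan (g10) RE-DEAL 2026-09-04T02:26:33Z); 2026-09-04.
-/
import Summits.HodgeConjecture.HodgeConjecture.Theorems.K2LiuIwasawaDatumAdapted    -- ★ #31p payer: the adapted datum and its `archPart`∕`finPart` bookkeeping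
import HarnessLib

/-!
# Crux `HLiu418`, Track B road `K2_Liu`, unit U5d «`Z_S`», socket #33s — organ O33.7a:
# datum bookkeeping for the smear step — every element of a compact `K ≤ H(𝔸)` factors `t = archToAdelic(archPart t) · finAdelicToAdelic(finPart t)`
# through the compact archimedean image of `K`, and a right-`K′_f`-invariant `φ` (`K′_f` open) has finitely many finite-part translates on `K`

Cell `hodgecm-mathlib`, crux item hLiu418 = `stmt-HodgeConjecture-24832`, route of record `HCCMUnconditional`; squad K2 ∕ K2Liu,
LEAD F0P6-plan (g10), planner K2Liu-plan (g2), prover K2Liu-p06 (g2).  THEOREMS ONLY (no `def`, no instance, no notation, no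
named-fact hypothesis, no `sorry`, default heartbeats); lane `--supports stmt-HodgeConjecture-24832` (count-neutral helper).

WHAT IS PROVED (doubled unitary group `H(𝔸) = HA`, ★ `UnitaryGroup.archPart ∕ finPart ∕ archToAdelic ∕ finAdelicToAdelic`).  These are the
hypotheses `hK` ∕ `hKinv` of ★ O33.5b `K2LiuZetaSKFiniteSmear.exists_smear_admissible_zetaS_ne_zero`, discharged for a compact `K` and the compact
group `𝕂 := archPart(K) ≤ H_∞` with `a := archToAdelic|_𝕂`:
* `isCompact_map_archPart` — `archPart(K)` is compact for compact `K`;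
* `commute_finAdelicToAdelic_archToAdelic`, `commute_of_archPart_eq_one`, `commute_and_invariant_of_archPart_eq_one` — finite-adelic elements (in
  particular every `k` with `k_∞ = 1`, i.e. all of `K^S_H`) commute with `archToAdelic(H_∞)`, and fix every right-`K′_f`-invariant `φ` when `k_f ∈ K′_f`;
* `eq_archToAdelic_mul_finAdelicToAdelic` — `t = archToAdelic(archPart t) · finAdelicToAdelic(finPart t)`;
* `exists_finset_forall_translate_eq` — **finite type at the finite places**: if `φ(h · finAdelicToAdelic f) = φ(h)` for all `f` in an OPEN subgroup
  `K′_f` of `H(𝔸_f)`, then on the compact `K` the finite-part translates `φ(· finAdelicToAdelic(finPart t))`, `t ∈ K`, run through FINITELY many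
  functions `φ(· finAdelicToAdelic r)`, `r` in a finite set of representatives (compactness of `finPart(K)`, cosets of the open `K′_f`);
* `exists_factorisation_through_archPart` — the packaged hypothesis `hK` of the smear step: every `t ∈ K` is `archToAdelic(k₀) · u` with `k₀ ∈ archPart(K)`,
  `u = finAdelicToAdelic(finPart t)` commuting with `archToAdelic(H_∞)`, and `φ(· u) = φ(· finAdelicToAdelic r)` for some representative `r`.
[Borel–Jacquet (1979) §4.1: `K`-finite = `K_∞`-finite ⊗ smooth.]

HONEST LABEL.  Count-neutral scaffold file of the K2_Liu road; it pays nothing by itself: `HC_CM` is proved only modulo the 7 printed citations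
(2 remaining named inputs: hLiu418 = `stmt-HodgeConjecture-24832`, h413 = `stmt-HodgeConjecture-24833`) until rung 0 closes.

## References
* [BorelJacquet1979] A. Borel, H. Jacquet, PSPM 33.1 (1979): §4.1 (`G(𝔸) = G_∞ × G(𝔸_f)`, admissibility: `K_∞`-finite and smooth).
* [PlatonovRapinchuk1994] V. Platonov, A. Rapinchuk, *Algebraic Groups and Number Theory* (1994): §5.1 (adelic points, compact open subgroups).
* [Liu2011] Y. Liu, Algebra Number Theory 5 (2011): §2C p. 863 (standard `K`-finite sections).
-/

set_option autoImplicit false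
set_option linter.dupNamespace false

noncomputable section

open scoped Topology
open Filter Set NumberField IsDedekindDomain

namespace Summit.HodgeConjecture.HodgeConjecture.Cruxes.HLiu418.K2LiuZetaSDatumFactorisation

open Literature.NumberTheory.Automorphic Literature.NumberTheory.Automorphic.UnitaryGroup
open Literature.NumberTheory.GelbartRogawski1991 Literature.NumberTheory.GelbartRogawski1991.GRConstruction
open Literature.NumberTheory.K2Lit.SiegelDoubled
open Summit.HodgeConjecture.HodgeConjecture.Cruxes.HLiu418.K2LiuIwasawaDatumAdapted

/-! ### §1 Generic unitary-group bookkeeping (`U(J)` over `E ∕ F`) -/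

section Generic

variable (F E : Type) [Field F] [NumberField F] [Field E] [NumberField E] [Algebra F E]
  (c : E ≃ₐ[F] E) (N : ℕ) (J : Matrix (Fin N) (Fin N) E)

/-- Finite-adelic elements commute with archimedean ones in `U(J)(𝔸_F) = U(J)(F_∞) × U(J)(𝔸_{F,f})` (★ `commute_archToAdelic_finAdelicToAdelic`).
[cite: BorelJacquet1979, §4.1] -/
theorem commute_finAdelicToAdelic_archToAdelic (b : finAdelic F E c N J) (a : arch F E c N J) :
    finAdelicToAdelic F E c N J b * archToAdelic F E c N J a = archToAdelic F E c N J a * finAdelicToAdelic F E c N J b :=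
  (commute_archToAdelic_finAdelicToAdelic F E c N J a b).eq.symm

/-- An element with trivial archimedean part commutes with `U(J)(F_∞)`. [cite: BorelJacquet1979, §4.1] -/
theorem commute_of_archPart_eq_one {g : (adelicGroupData F E c N J).Adelic} (hg : archPart F E c N J g = 1) (a : arch F E c N J) :
    g * archToAdelic F E c N J a = archToAdelic F E c N J a * g := by
  rw [eq_finAdelicToAdelic_finPart_of_archPart_eq_one hg]
  exact commute_finAdelicToAdelic_archToAdelic F E c N J _ a

/-- `g = archToAdelic(archPart g) · finAdelicToAdelic(finPart g)` (★ `archToAdelic_mul_finAdelicToAdelic`). [cite: BorelJacquet1979, §4.1] -/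
theorem eq_archToAdelic_mul_finAdelicToAdelic (g : (adelicGroupData F E c N J).Adelic) :
    g = archToAdelic F E c N J (archPart F E c N J g) * finAdelicToAdelic F E c N J (finPart F E c N J g) :=
  (archToAdelic_mul_finAdelicToAdelic F E c N J g).symm

/-- The archimedean image of a compact subgroup is compact (★ `continuous_archPart`). [cite: PlatonovRapinchuk1994, §5.1] -/
theorem isCompact_map_archPart {K : Subgroup (adelicGroupData F E c N J).Adelic} (hK : IsCompact (K : Set (adelicGroupData F E c N J).Adelic)) :
    IsCompact (K.map (archPart F E c N J) : Set (arch F E c N J)) := by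
  rw [Subgroup.coe_map]
  exact hK.image (continuous_archPart F E c N J)

/-- **Finite type at the finite places.**  If `φ(h · finAdelicToAdelic f) = φ(h)` for all `f` in an OPEN subgroup `K′_f ≤ U(J)(𝔸_{F,f})` and all `h`, then
for a compact `K ≤ U(J)(𝔸_F)` there is a finite set `R ⊆ U(J)(𝔸_{F,f})` such that for every `t ∈ K`,
`φ(· finAdelicToAdelic(finPart t)) = φ(· finAdelicToAdelic r)` for some `r ∈ R` (`finPart(K)` is compact and covered by the open cosets `r K′_f`).
[cite: BorelJacquet1979, §4.1] [cite: PlatonovRapinchuk1994, §5.1] -/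
theorem exists_finset_forall_translate_eq {X : Type*} {K : Subgroup (adelicGroupData F E c N J).Adelic}
    (hK : IsCompact (K : Set (adelicGroupData F E c N J).Adelic))
    (Kf : Subgroup (finAdelic F E c N J)) (hKfo : IsOpen (Kf : Set (finAdelic F E c N J)))
    (φ : (adelicGroupData F E c N J).Adelic → X) (hφ : ∀ f ∈ Kf, ∀ h, φ (h * finAdelicToAdelic F E c N J f) = φ h) :
    ∃ R : Finset (finAdelic F E c N J), ∀ t ∈ K, ∃ r ∈ R,
      (fun h => φ (h * finAdelicToAdelic F E c N J (finPart F E c N J t))) = fun h => φ (h * finAdelicToAdelic F E c N J r) := by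
  have hC : IsCompact (finPart F E c N J '' (K : Set (adelicGroupData F E c N J).Adelic)) := hK.image (continuous_finPart F E c N J)
  -- the open cosets `x ↦ {y | x⁻¹ y ∈ K′_f}` cover `finPart(K)`
  obtain ⟨R, -, hRcov⟩ := hC.elim_nhds_subcover (fun x => {y | x⁻¹ * y ∈ (Kf : Set (finAdelic F E c N J))}) fun x _ =>
    (hKfo.preimage (continuous_const.mul continuous_id)).mem_nhds (by simp [Kf.one_mem])
  refine ⟨R, fun t ht => ?_⟩
  obtain ⟨r, hr, hrt⟩ : ∃ r ∈ R, r⁻¹ * finPart F E c N J t ∈ (Kf : Set (finAdelic F E c N J)) := by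
    have h := hRcov ⟨t, ht, rfl⟩
    simp only [mem_iUnion, mem_setOf_eq, exists_prop] at h
    exact h
  refine ⟨r, hr, funext fun h => ?_⟩
  have hsplit : finAdelicToAdelic F E c N J (finPart F E c N J t) =
      finAdelicToAdelic F E c N J r * finAdelicToAdelic F E c N J (r⁻¹ * finPart F E c N J t) := by
    rw [← map_mul, mul_inv_cancel_left]
  change φ (h * finAdelicToAdelic F E c N J (finPart F E c N J t)) = φ (h * finAdelicToAdelic F E c N J r)
  rw [hsplit, ← mul_assoc, hφ _ hrt]

/-- **The factorisation hypothesis of the smear step** (★ O33.5b `exists_smear_admissible_zetaS_ne_zero`, `hK`), for a compact `K ≤ U(J)(𝔸_F)`,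
`𝕂 := archPart(K)`, `a := archToAdelic ∘ subtype`, and a right-`K′_f`-invariant `φ` with `K′_f` open: every `t ∈ K` is `a(k₀) · u` with
`u = finAdelicToAdelic(finPart t)` commuting with `a(𝕂)` and `φ(· u)` one of the finitely many `φ(· finAdelicToAdelic r)`, `r ∈ R`.
[cite: BorelJacquet1979, §4.1] -/
theorem exists_factorisation_through_archPart {X : Type*} {K : Subgroup (adelicGroupData F E c N J).Adelic}
    (hK : IsCompact (K : Set (adelicGroupData F E c N J).Adelic))
    (Kf : Subgroup (finAdelic F E c N J)) (hKfo : IsOpen (Kf : Set (finAdelic F E c N J)))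
    (φ : (adelicGroupData F E c N J).Adelic → X) (hφ : ∀ f ∈ Kf, ∀ h, φ (h * finAdelicToAdelic F E c N J f) = φ h) :
    ∃ R : Finset (finAdelic F E c N J), ∀ t ∈ K,
      ∃ (k₀ : K.map (archPart F E c N J)) (u : (adelicGroupData F E c N J).Adelic) (r : R),
        t = ((archToAdelic F E c N J).comp (K.map (archPart F E c N J)).subtype) k₀ * u ∧
        (∀ k : K.map (archPart F E c N J),
          u * ((archToAdelic F E c N J).comp (K.map (archPart F E c N J)).subtype) k =
            ((archToAdelic F E c N J).comp (K.map (archPart F E c N J)).subtype) k * u) ∧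
        (fun h => φ (h * u)) = fun h => φ (h * finAdelicToAdelic F E c N J (r : finAdelic F E c N J)) := by
  obtain ⟨R, hR⟩ := exists_finset_forall_translate_eq F E c N J hK Kf hKfo φ hφ
  refine ⟨R, fun t ht => ?_⟩
  obtain ⟨r, hr, hφr⟩ := hR t ht
  refine ⟨⟨archPart F E c N J t, Subgroup.mem_map_of_mem _ ht⟩, finAdelicToAdelic F E c N J (finPart F E c N J t), ⟨r, hr⟩,
    eq_archToAdelic_mul_finAdelicToAdelic F E c N J t, fun k => commute_finAdelicToAdelic_archToAdelic F E c N J _ _, hφr⟩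

end Generic

/-! ### §2 `K^S_H`-type elements: commute with `U(J)(F_∞)` and fix right-`K′_f`-invariant functions -/

section Invariance

variable (F E : Type) [Field F] [NumberField F] [Field E] [NumberField E] [Algebra F E]
  (c : E ≃ₐ[F] E) (N : ℕ) (J : Matrix (Fin N) (Fin N) E)

/-- **The hypothesis `hKinv` of the smear step for `K^S`-type elements.**  If `k ∈ U(J)(𝔸_F)` has `k_∞ = 1` and its finite part lies in a subgroup
`K′_f` under which `φ` is right-invariant, then `k` commutes with `archToAdelic(U(J)(F_∞))` and fixes `φ` on the right (typed on the datum's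
`Adelic`, which is `H(𝔸) = HA` definitionally in the doubled frame). [cite: BorelJacquet1979, §4.1] -/
theorem commute_and_invariant_of_archPart_eq_one {X : Type*} (Kf : Subgroup (finAdelic F E c N J))
    (φ : (adelicGroupData F E c N J).Adelic → X) (hφ : ∀ f ∈ Kf, ∀ h, φ (h * finAdelicToAdelic F E c N J f) = φ h)
    {k : (adelicGroupData F E c N J).Adelic} (hkinf : archPart F E c N J k = 1) (hkf : finPart F E c N J k ∈ Kf) :
    (∀ a : arch F E c N J, k * archToAdelic F E c N J a = archToAdelic F E c N J a * k) ∧ ∀ h, φ (h * k) = φ h := by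
  refine ⟨commute_of_archPart_eq_one F E c N J hkinf, fun h => ?_⟩
  rw [eq_finAdelicToAdelic_finPart_of_archPart_eq_one hkinf]
  exact hφ _ hkf h

end Invariance

end Summit.HodgeConjecture.HodgeConjecture.Cruxes.HLiu418.K2LiuZetaSDatumFactorisation

end
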